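import Literature.AnabelianGeometry.SemiGraphs.TemperedDecompositionCompact
import HarnessLib

/-!
# Tempered groups: compact subgroups of a completion pull back to compact subgroups — WITHOUT (RF)

Mochizuki, *Semi-graphs of anabelioids*, Publ. RIMS **42** (2006), §3 Def. 3.1 (i) p. 33 (the tree's
`IsTempered`: complete inverse-limit form) [cite: MochizukiSemiAnbd2006, Def 3.1(i) p.33]; used at
[IUTchI] §2 p. 45, proof of Prop. 2.1: "Since `Λ`, `γ·Λ·γ⁻¹` are compact subgroups of `Π^tp_𝔾` …" —
compactness of `γ·Λ·γ⁻¹` for the TEMPERED topology, where only `γ·Λ·γ⁻¹ ⊆ Π^tp_𝔾 ⊆ Π̂_𝔾` is known.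

`TemperedCompactPreimage.lean` (abc-iut-L5-t11, `IsTempered.isCompact_comap`) proves this step (A0)
under the residual hypothesis (RF) "open normal subgroups closed for the topology induced from `Π̂_𝔾`
are cofinal" (= residual-`Σ̂`-ness of the virtually free quotients; for general `Σ̂` "an input the
instantiation must supply").  This proof-only file REMOVES (RF) in favour of first countability of
`Π^tp_𝔾` (Galois-countability, [IUTchI] Rmk. 2.5.3 (i) (T1)/(T6) — a field of every
`TemperedPiChart`), by the open mapping theorem for tempered groups (`TemperedOpenMapping.lean`):

* `IsTempered.isCompact_comap_of_firstCountable` — `T` tempered and first countable, `ι : T ↪ P` a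
  continuous injective homomorphism into a Hausdorff group, `K ⊆ ι(T)` a compact subgroup of `P`:
  then `ι⁻¹(K)` is compact.  Proof: `ι⁻¹(K)` is closed, hence tempered
  (`IsTempered.subgroup_of_isClosed`); `ι : ι⁻¹(K) → K` is a continuous bijective homomorphism onto
  a compact Hausdorff group, hence OPEN (`IsTempered.isOpenMap_of_surjective`); an open continuous
  surjection with compact (trivial) kernel onto a compact group has compact source
  (`IsTempered.compactSpace_of_isOpenMap_of_isCompact_ker`).

No statement of either paper is strengthened; nothing here bears on [IUTchIII] Cor. 3.12.
-/

namespace Literature.AnabelianGeometry.SemiGraphs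

open Topology Filter Set

universe u v

variable {T : Type u} [Group T] [TopologicalSpace T] [IsTopologicalGroup T]
variable {P : Type v} [Group P] [TopologicalSpace P] [IsTopologicalGroup P]

/-- **(A0) of [IUTchI] Prop. 2.1 without (RF)**: for `T` tempered ([SemiAnbd] Def. 3.1 (i)) with
first-countable topology, `ι : T ↪ P` a continuous injective homomorphism into a Hausdorff group, and
`K` a compact subgroup of `P` contained in `ι(T)`, the subgroup `ι⁻¹(K) ⊆ T` is compact — the step
"`γ·Λ·γ⁻¹` [is a] compact subgroup of `Π^tp_𝔾`" of [IUTchI] p. 45, for ANY `Σ̂`.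
[cite: MochizukiSemiAnbd2006, Def 3.1(i) p.33] -/
theorem IsTempered.isCompact_comap_of_firstCountable [FirstCountableTopology T] [T2Space P]
    (hT : IsTempered T) (ι : T →* P) (hι : Continuous ι) (hιi : Function.Injective ι)
    (K : Subgroup P) (hK : IsCompact (K : Set P)) (hKr : K ≤ ι.range) :
    IsCompact ((K.comap ι : Subgroup T) : Set T) := by
  classical
  set L : Subgroup T := K.comap ι with hLdef
  -- `L` is closed, hence tempered, and first countable
  have hLc : IsClosed (L : Set T) := by
    rw [hLdef, Subgroup.coe_comap]
    exact hK.isClosed.preimage hι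
  have hLt : IsTempered L := hT.subgroup_of_isClosed L hLc
  haveI : FirstCountableTopology L := Topology.IsInducing.subtypeVal.firstCountableTopology
  -- `K` is a compact Hausdorff group
  haveI : CompactSpace K := isCompact_iff_compactSpace.1 hK
  -- `ι : L → K`, a continuous bijective homomorphism
  let f : L →* K :=
    { toFun := fun l => ⟨ι l, l.2⟩
      map_one' := Subtype.ext (by simp)
      map_mul' := fun a b => Subtype.ext (by simp) }
  have hfc : Continuous f :=
    continuous_induced_rng.2 (hι.comp continuous_subtype_val)
  have hfs : Function.Surjective f := by
    rintro ⟨k, hk⟩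
    obtain ⟨t, ht⟩ := hKr hk
    exact ⟨⟨t, show ι t ∈ K by rw [ht]; exact hk⟩, Subtype.ext ht⟩
  have hfo : IsOpenMap f := hLt.isOpenMap_of_surjective f hfc hfs
  have hker : IsCompact (f.ker : Set L) := by
    have : f.ker = ⊥ := by
      rw [MonoidHom.ker_eq_bot_iff]
      rintro ⟨a, ha⟩ ⟨b, hb⟩ h
      exact Subtype.ext (hιi (congrArg Subtype.val h))
    rw [this]
    simp
  haveI : CompactSpace L := hLt.compactSpace_of_isOpenMap_of_isCompact_ker f hfo hfs hker
  exact isCompact_iff_compactSpace.2 this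

end Literature.AnabelianGeometry.SemiGraphs
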